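import Literature.MathematicalPhysics.QuantumFieldTheory.Balaban1983to89.B16NodeKnitRecord13CoPH
import Literature.MathematicalPhysics.QuantumFieldTheory.Balaban1983to89.B14Cor3

/-!
# BalabanUVNodes ∕ N13 — [III] COR. 3's p. 264 SENTENCE AT NODE 00's STAGE-13 RECORD OVER THE RECORD's OWN (2.18) REPRESENTATION: (0.1) ∕ (2.50), `Cor3With`,
# `Cor3_250` and K1⁷'s (B) conjunct `EndStatementBPrinted` at `datumOfRecord₁₃CoPH` FROM THEOREM 1 AT THE RECORD + THE FOUR LEAVES U1 ∕ U2 ∕ L1 ∕ L2 of adv3's `B14Cor3` READ AT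
# `Node00.reprOfRecord₁₃ θ P k` (index = the histories `SeqOfRecord`, `χ = chiSeqOfRecord`, `𝐓e^A = slotsOfRecord`) — LEAF (H) «(2.18) holds» DISCHARGED by def-T's `holds_densOfRecord₁₃`
# (`ρ_k := eval rep_k`, by construction); NO free (1.72) representation, no cube geometry, no curly-bracket gas (Track A, DAG node N13 = [B16]; cluster K1 — K1⁷
# `StabilityBAtRecordR13SepCoPH` = stmt-QuantumFields-20542, helper; seat `pub-ymgap-dag-n13-w3` g0, plan g79∕g80 REBALANCE № 5 «Cor 3 p.264 sentence at the record BY NAME»; 2026-08-28; count-neutral)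

HONEST FRAMING.  Count-neutral kernel BOOKKEEPING BY NAME; nothing of Bałaban's is asserted: [III] Corollary 3 is NOT proved — its printed one-sentence proof (p. 264 «we estimate the integral
∫dV_k ρ_k by a sum of terms similar to the one considered in Sect. 3 [6], e.g., see (3.42) … hence we have the same result for this scale») is adv3's FOUR LEAVES, all DISPLAYED HERE AS
HYPOTHESES read at the record's own histories: (U1) the per-history majorant `χ_k(s)(V)·slot_k(s)(V) ≤ major s` ([V] p. 387 via (1.89); ASSERTED BY SIMILARITY in print), (U2) the
transferred combinatorial estimate `Σ_s major s ≤ exp(e₊(g_k)|T₁^{(k)}|)` ([6] (3.42), transfer NOT carried out in print, GAPS G-adv3-1), (L1) history-wise non-negativity (UNPRINTED in d = 4,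
G-adv3-2 (L1)), (L2) the all-small history's lower bound against the CORE's `χ_k = chiβOfRecord₁₃` (the (2.9) species; UNPRINTED in d = 4, G-adv3-2 (L2) — and WHICH history `s₀` carries it,
with `χ^{(2.9)}_k ≤ χ_k(s₀)`-type compatibility, is part of the binder).  Theorem 1 at the record (`B16.Thm1Printed`, N11 ∕ N13's 𝐑-row) is a HYPOTHESIS where used.  What IS discharged:
leaf (H) — at NODE 00's record the (2.18) representation is KNOWN (`reprOfRecord₁₃`, `holds_densOfRecord₁₃`), so module 36 §4's free `R : Repr172` with `hH : R.Holds (densOfRecord₁₃ …)`,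
its χ-dictionary, cube catalogue, factor leaves, (1.90) gas and (2.49) binders are ALL REPLACED by the four leaves on the record's histories — the p. 264 sentence itself, at the record's
objects.  N13 NOT discharged; K0⁷ ∕ K1⁷ NOT closed; counts unmoved (discharged 5∕27 · Track A 5∕28).  The Yang–Mills mass gap (Clay) is NOT proved by any of this; rung R4 `BalabanLadder.UV`
(conditional finite-𝕋⁴ bookkeeping) is the only thing the K-items close.  ONE finite four-torus programme at fixed `ε = L^{-K}`; nothing continuum ∕ ℝ⁴ ∕ OS.  No `sorry`, `def`,
`instance`, `notation`.

WHAT THIS FILE PROVES.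
§1 faces (`rfl`): `reprOfRecord₁₃_Adm ∕ _χ ∕ _TexpA` (the record's (2.18) data ARE the histories, `chiSeqOfRecord`, `slotsOfRecord`), `densOfRecord₁₃_eq_sum` (`ρ_k(V) = Σ_s χ_k(s)(V)·slot_k(s)(V)`).
§2 ONE RUN, ONE STEP (any `k`, in particular `k ≥ 1`): ★★ `uvIneq_at_record₁₃CoPH_of_repr218Leaves` — (0.1) at every configuration of `((datumOfRecord₁₃CoPH θ h).C P, k)` from U1∕U2∕L1∕L2 at
   `reprOfRecord₁₃ θ P k` (adv3's `density_le_of_repr218` ∕ `density_ge_of_repr218` + `holds_densOfRecord₁₃` + module 36's `uvIneq_at_record₁₃CoPH_iff`); `densOfRecord₁₃_le_of_U1_U2`,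
   `le_densOfRecord₁₃_of_L1_L2` (the two halves in n24-c's `hUV` currency); `histTerm_pos_of_L2_of_chiβ_pos` (what (L2) demands of the two χ's: `supp χ^{(2.9)}_k ⊆ supp χ_k(s₀)` —
   the located compatibility between def-T's core χ and the all-small history's `chiSeqOfRecord`, displayed not decided).
§3 THE RUN FAMILY: ★★★ `cor3With_datumOfRecord₁₃CoPH_of_repr218Leaves` (leaves guarded by the interval hypothesis AND `SLaw₁₃CoPH` — Theorem 1's conclusion at the record — as adv3 guards
   them; `hS` = Thm 1's conclusion on `]0, γ]`), ★★★ `cor3_250_datumOfRecord₁₃CoPH_of_thm1_of_repr218Leaves` (`Thm1Printed` + leaves on `]0, γ]` ⇒ `Cor3_250`, the `min γ γ₁` logic of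
   adv3's `cor3_250_of_leaves`), ★★★ `endStatementBPrinted_datumOfRecord₁₃CoPH_of_thm1_of_repr218Leaves` — K1⁷'s (B) AT THE RECORD = Theorem 1 at the record + the four leaves on the
   record's histories; SepCoPH twins by def-T's `rfl` bridge.
§4 n24-c's binder: ★ `hUV₁₃CoPH_of_repr218Leaves` — the row «(UV₁₃) `hUV`» of the K1⁷ engines (`B16NodeKnitRecord13CoPH.b16_main_at_record₁₃CoPH`'s `hUV13` ∕ `N24…_pointed`'s `hUV`) in
   its own letters from the four leaves, every `k ≤ P.K` (k = 0 included; dag-n13-w1 supplies k = 0 outright).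

Sources: [Balaban1988Convergent] (2.17)–(2.18) p.257, Thm 1 p.262, (2.49)–(2.50) + the sentence before Cor. 3 p.264; [Balaban1982Higgs2] (3.42) p.592 (via adv3's leaf U2, cite only);
[Balaban1989LargeFieldII] Thm 1 p.355, (0.1) pp.355–356, (1.89) p.387, p.391.
-/

noncomputable section

open MeasureTheory
open scoped BigOperators

namespace Summit.QuantumFields.YangMills.BalabanUVNodes.N13Cor3Repr218LeavesAtRecord13CoPH

open Literature.MathematicalPhysics.QuantumFieldTheory.Balaban1983to89
open T4Continuum T4DatumAssembly Node00 DagBinding FlowStepRuns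
open B14Cor3 (density_le_of_repr218 density_ge_of_repr218 inInterval_of_le)
open B16NodeKnitRecord13CoPH (uvIneq_at_record₁₃CoPH_iff)

variable (F : T4Family) (N : ℕ) [NeZero N]

/-! ## §1. The record's (2.18) data ARE the histories of record (`rfl` faces) -/

section Faces

variable (θ : Stage13HParams F N) (P : B12.RunParams) (k : ℕ)

/-- The index type of `rep_k` of record IS the type of histories `SeqOfRecord` of the run (`rfl`). [cite: Balaban1988Convergent, (2.1)–(2.3) p.255, (2.18) p.257 (bookkeeping)] -/
theorem reprOfRecord₁₃_Adm :
    (reprOfRecord₁₃ F N θ.toStage13Params P k).Adm = SeqOfRecord F θ.ν θ.τ9.M (gOfRecord₁₃ F N θ.toStage13Params P) P.K k := rfl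

/-- The characteristic functions of `rep_k` of record ARE `chiSeqOfRecord` (`rfl`). [cite: Balaban1988Convergent, (2.17) p.257 (bookkeeping)] -/
theorem reprOfRecord₁₃_χ :
    (reprOfRecord₁₃ F N θ.toStage13Params P k).χ = chiSeqOfRecord F N θ.ν θ.τ9.M (gOfRecord₁₃ F N θ.toStage13Params P) P.K k := rfl

/-- The `𝐓_k e^{A_k}` data of `rep_k` of record ARE the post-𝐑 slots of record `slotsOfRecord … P g k` (`rfl`). [cite: Balaban1988Convergent, (2.18) p.257 (bookkeeping)] -/
theorem reprOfRecord₁₃_TexpA :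
    (reprOfRecord₁₃ F N θ.toStage13Params P k).TexpA =
      slotsOfRecord F N θ.ν θ.τ9 (EOfRecord₁₃ F N θ.toStage13Params) (wOfRecord₉ F N θ.toStage9Params) θ.ppSel P (gOfRecord₁₃ F N θ.toStage13Params P) k := rfl

/-- **(2.18) AT THE RECORD, EXPLICIT**: `ρ_k(V) = Σ_s χ_k(s)(V) · slot_k(s)(V)` over the histories of record (def-T's `holds_densOfRecord₁₃`, by construction). [cite: Balaban1988Convergent, (2.18) p.257] -/
theorem densOfRecord₁₃_eq_sum (V : GaugeField (F.P P.K) k (SU N)) :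
    densOfRecord₁₃ F N θ.toStage13Params P k V =
      ∑ s : (reprOfRecord₁₃ F N θ.toStage13Params P k).Adm,
        (reprOfRecord₁₃ F N θ.toStage13Params P k).χ s V * (reprOfRecord₁₃ F N θ.toStage13Params P k).TexpA s V :=
  holds_densOfRecord₁₃ F N θ.toStage13Params P k V

end Faces

/-! ## §2. ONE RUN, ONE STEP: (0.1) at the record from the four leaves on the record's histories (leaf H discharged) -/

section OneStep

variable (θ : Stage13HParams F N) (h : θ.Provisos₁₃CoPH F N) (P : B12.RunParams) (k : ℕ)

/-- UPPER HALF at the record from (U1) + (U2): `ρ_k(V) ≤ exp(E₊·|T₁^{(k)}|)` for every `V`. [cite: Balaban1988Convergent, Cor. 3 (2.50) p.264 (bookkeeping over the p.264 sentence)] -/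
theorem densOfRecord₁₃_le_of_U1_U2 (major : (reprOfRecord₁₃ F N θ.toStage13Params P k).Adm → ℝ) (Ep : ℝ)
    (hU1 : ∀ s V, (reprOfRecord₁₃ F N θ.toStage13Params P k).χ s V * (reprOfRecord₁₃ F N θ.toStage13Params P k).TexpA s V ≤ major s)
    (hU2 : ∑ s, major s ≤ Real.exp (Ep * (Fintype.card (Site (F.P P.K) k) : ℝ))) :
    ∀ V : GaugeField (F.P P.K) k (SU N), densOfRecord₁₃ F N θ.toStage13Params P k V ≤ Real.exp (Ep * (Fintype.card (Site (F.P P.K) k) : ℝ)) :=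
  density_le_of_repr218 _ (holds_densOfRecord₁₃ F N θ.toStage13Params P k) major hU1 hU2

/-- LOWER HALF at the record from (L1) + (L2): `χ^{(2.9)}_k(V)·exp[−(1∕g_k²)A(U_k(V)) − E₋·|T₁^{(k)}|] ≤ ρ_k(V)` for every `V`, the minorant carried by the history `s₀`.
[cite: Balaban1988Convergent, Cor. 3 (2.50) p.264; Balaban1989LargeFieldII, p.391 (bookkeeping)] -/
theorem le_densOfRecord₁₃_of_L1_L2 (s₀ : (reprOfRecord₁₃ F N θ.toStage13Params P k).Adm) (Em : ℝ)
    (hL1 : ∀ s V, 0 ≤ (reprOfRecord₁₃ F N θ.toStage13Params P k).χ s V * (reprOfRecord₁₃ F N θ.toStage13Params P k).TexpA s V)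
    (hL2 : ∀ V, chiβOfRecord₁₃ F N θ.toStage13Params P.K (gOfRecord₁₃ F N θ.toStage13Params P) k V *
        Real.exp (-(1 / (gOfRecord₁₃ F N θ.toStage13Params P k) ^ 2 * wilsonBGOfRecord F N θ.εbg P k V) - Em * (Fintype.card (Site (F.P P.K) k) : ℝ)) ≤
      (reprOfRecord₁₃ F N θ.toStage13Params P k).χ s₀ V * (reprOfRecord₁₃ F N θ.toStage13Params P k).TexpA s₀ V) :
    ∀ V : GaugeField (F.P P.K) k (SU N),
      chiβOfRecord₁₃ F N θ.toStage13Params P.K (gOfRecord₁₃ F N θ.toStage13Params P) k V *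
          Real.exp (-(1 / (gOfRecord₁₃ F N θ.toStage13Params P k) ^ 2 * wilsonBGOfRecord F N θ.εbg P k V) - Em * (Fintype.card (Site (F.P P.K) k) : ℝ)) ≤
        densOfRecord₁₃ F N θ.toStage13Params P k V :=
  density_ge_of_repr218 _ (holds_densOfRecord₁₃ F N θ.toStage13Params P k) s₀ _ hL1 hL2

/-- **★★ (0.1) AT THE RECORD, ONE RUN ∕ ONE STEP (any `k`), FROM THE FOUR LEAVES ON THE RECORD's HISTORIES** — adv3's `uvIneq_of_termData` logic at `reprOfRecord₁₃ θ P k` with leaf (H)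
DISCHARGED (`holds_densOfRecord₁₃`): from (U1) `hU1`, (U2) `hU2`, (L1) `hL1`, (L2) `hL2` (the all-small history `s₀` named by the supplier) conclude `B16.UVIneq ((datumOfRecord₁₃CoPH F N θ h).C P) k V E₋ E₊`
at every configuration.  No free representation, no cube catalogue, no (1.90) gas, no (2.49) binder: those are INSIDE U1∕U2∕L2 for whoever proves them.  CONDITIONAL on the four leaves.
[cite: Balaban1988Convergent, Cor. 3 (2.50) and the sentence before it, p.264; Balaban1989LargeFieldII, (0.1) p.356] -/
theorem uvIneq_at_record₁₃CoPH_of_repr218Leaves (major : (reprOfRecord₁₃ F N θ.toStage13Params P k).Adm → ℝ)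
    (s₀ : (reprOfRecord₁₃ F N θ.toStage13Params P k).Adm) (Em Ep : ℝ)
    (hU1 : ∀ s V, (reprOfRecord₁₃ F N θ.toStage13Params P k).χ s V * (reprOfRecord₁₃ F N θ.toStage13Params P k).TexpA s V ≤ major s)
    (hU2 : ∑ s, major s ≤ Real.exp (Ep * (Fintype.card (Site (F.P P.K) k) : ℝ)))
    (hL1 : ∀ s V, 0 ≤ (reprOfRecord₁₃ F N θ.toStage13Params P k).χ s V * (reprOfRecord₁₃ F N θ.toStage13Params P k).TexpA s V)
    (hL2 : ∀ V, chiβOfRecord₁₃ F N θ.toStage13Params P.K (gOfRecord₁₃ F N θ.toStage13Params P) k V *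
        Real.exp (-(1 / (gOfRecord₁₃ F N θ.toStage13Params P k) ^ 2 * wilsonBGOfRecord F N θ.εbg P k V) - Em * (Fintype.card (Site (F.P P.K) k) : ℝ)) ≤
      (reprOfRecord₁₃ F N θ.toStage13Params P k).χ s₀ V * (reprOfRecord₁₃ F N θ.toStage13Params P k).TexpA s₀ V) :
    ∀ V : GaugeField (F.P P.K) k (SU N), B16.UVIneq ((datumOfRecord₁₃CoPH F N θ h).C P) k V Em Ep :=
  fun V => (uvIneq_at_record₁₃CoPH_iff F N θ h P k V Em Ep).2
    ⟨le_densOfRecord₁₃_of_L1_L2 F N θ P k s₀ Em hL1 hL2 V, densOfRecord₁₃_le_of_U1_U2 F N θ P k major Ep hU1 hU2 V⟩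


/-- **WHAT LEAF (L2) AT THE RECORD DEMANDS OF THE TWO χ's (located, kernel-visible)**: if (L2) holds at step `k` with the all-small history `s₀`, then wherever the CORE's (2.9) species
`χ^{(2.9)}_k = chiβOfRecord₁₃` is positive, the history term `χ_k(s₀)(V)·slot_k(s₀)(V)` is positive — in particular `supp χ^{(2.9)}_k ⊆ supp χ_k(s₀)` (the (2.17) product of the all-small
history).  So (L2) is satisfiable at the record ONLY IF def-T's core χ (director-ym LINE №126 C4 (i)) is dominated in support by the all-small history's `chiSeqOfRecord`; this file does not
decide that compatibility — it displays it. [cite: Balaban1988Convergent, (2.17) p.257, (2.50) p.264; Balaban1987RG1, (2.9) p.266 (bookkeeping)] -/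
theorem histTerm_pos_of_L2_of_chiβ_pos (s₀ : (reprOfRecord₁₃ F N θ.toStage13Params P k).Adm) (Em : ℝ)
    (hL2 : ∀ V, chiβOfRecord₁₃ F N θ.toStage13Params P.K (gOfRecord₁₃ F N θ.toStage13Params P) k V *
        Real.exp (-(1 / (gOfRecord₁₃ F N θ.toStage13Params P k) ^ 2 * wilsonBGOfRecord F N θ.εbg P k V) - Em * (Fintype.card (Site (F.P P.K) k) : ℝ)) ≤
      (reprOfRecord₁₃ F N θ.toStage13Params P k).χ s₀ V * (reprOfRecord₁₃ F N θ.toStage13Params P k).TexpA s₀ V)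
    (V : GaugeField (F.P P.K) k (SU N)) (hpos : 0 < chiβOfRecord₁₃ F N θ.toStage13Params P.K (gOfRecord₁₃ F N θ.toStage13Params P) k V) :
    0 < (reprOfRecord₁₃ F N θ.toStage13Params P k).χ s₀ V * (reprOfRecord₁₃ F N θ.toStage13Params P k).TexpA s₀ V :=
  lt_of_lt_of_le (mul_pos hpos (Real.exp_pos _)) (hL2 V)

end OneStep

/-! ## §3. THE RUN FAMILY: `Cor3With`, `Cor3_250` and K1⁷'s (B) conjunct at the record from Theorem 1 + the four guarded leaves -/

section Family

variable (θ : Stage13HParams F N) (h : θ.Provisos₁₃CoPH F N)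

/-- **★★★ [III] COR. 3 «WITH e±» AT THE RECORD FROM THE FOUR GUARDED LEAVES** — adv3's `cor3With_of_leaves` at the record's own representation family `P k ↦ reprOfRecord₁₃ θ P k` with leaf (H)
DISCHARGED: the leaves are guarded, as adv3 guards them («under the assumptions of Theorem 1»), by the interval hypothesis of the run AND Theorem 1's conclusion at the step in the record's
vocabulary `SLaw₁₃CoPH θ P k` (= `((datumOfRecord₁₃CoPH θ h).C P).Sect2Form k`, def-T's `Iff.rfl`); `hS` = Theorem 1's conclusion on `]0, γ]`.  Binders: the majorant family `major P k`, the
all-small history `s₀ P k`, the dependence functions `em ep`.  CONDITIONAL; nothing of Bałaban's asserted. [cite: Balaban1988Convergent, Thm 1 p.262, Cor. 3 (2.50) p.264] -/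
theorem cor3With_datumOfRecord₁₃CoPH_of_repr218Leaves (γ : ℝ) (em ep : ℝ → ℝ)
    (major : (P : B12.RunParams) → (k : ℕ) → (reprOfRecord₁₃ F N θ.toStage13Params P k).Adm → ℝ)
    (s₀ : (P : B12.RunParams) → (k : ℕ) → (reprOfRecord₁₃ F N θ.toStage13Params P k).Adm)
    (hS : ∀ P : B12.RunParams, ((datumOfRecord₁₃CoPH F N θ h).C P).flow.InInterval γ P.K → ∀ k, k ≤ P.K → SLaw₁₃CoPH F N θ P k)
    (hU1 : ∀ P : B12.RunParams, ((datumOfRecord₁₃CoPH F N θ h).C P).flow.InInterval γ P.K → ∀ k, k ≤ P.K → SLaw₁₃CoPH F N θ P k →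
      ∀ s V, (reprOfRecord₁₃ F N θ.toStage13Params P k).χ s V * (reprOfRecord₁₃ F N θ.toStage13Params P k).TexpA s V ≤ major P k s)
    (hU2 : ∀ P : B12.RunParams, ((datumOfRecord₁₃CoPH F N θ h).C P).flow.InInterval γ P.K → ∀ k, k ≤ P.K → SLaw₁₃CoPH F N θ P k →
      ∑ s, major P k s ≤ Real.exp (ep (gOfRecord₁₃ F N θ.toStage13Params P k) * (Fintype.card (Site (F.P P.K) k) : ℝ)))
    (hL1 : ∀ P : B12.RunParams, ((datumOfRecord₁₃CoPH F N θ h).C P).flow.InInterval γ P.K → ∀ k, k ≤ P.K → SLaw₁₃CoPH F N θ P k →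
      ∀ s V, 0 ≤ (reprOfRecord₁₃ F N θ.toStage13Params P k).χ s V * (reprOfRecord₁₃ F N θ.toStage13Params P k).TexpA s V)
    (hL2 : ∀ P : B12.RunParams, ((datumOfRecord₁₃CoPH F N θ h).C P).flow.InInterval γ P.K → ∀ k, k ≤ P.K → SLaw₁₃CoPH F N θ P k →
      ∀ V, chiβOfRecord₁₃ F N θ.toStage13Params P.K (gOfRecord₁₃ F N θ.toStage13Params P) k V *
          Real.exp (-(1 / (gOfRecord₁₃ F N θ.toStage13Params P k) ^ 2 * wilsonBGOfRecord F N θ.εbg P k V)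
            - em (gOfRecord₁₃ F N θ.toStage13Params P k) * (Fintype.card (Site (F.P P.K) k) : ℝ)) ≤
        (reprOfRecord₁₃ F N θ.toStage13Params P k).χ (s₀ P k) V * (reprOfRecord₁₃ F N θ.toStage13Params P k).TexpA (s₀ P k) V) :
    B16.Cor3With (datumOfRecord₁₃CoPH F N θ h).C γ em ep := by
  intro P hP k hk V
  have hs : SLaw₁₃CoPH F N θ P k := hS P hP k hk
  exact uvIneq_at_record₁₃CoPH_of_repr218Leaves F N θ h P k (major P k) (s₀ P k) _ _ (hU1 P hP k hk hs) (hU2 P hP k hk hs) (hL1 P hP k hk hs)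
    (hL2 P hP k hk hs) V

/-- Theorem 1 at the record, unfolded in the record's vocabulary: `B16.Thm1Printed ((datumOfRecord₁₃CoPH θ h).C)` gives `γ₁ > 0` with `SLaw₁₃CoPH θ P k` for every run in `]0, γ₁]` and every
`k ≤ K` (the datum's `Sect2Form` IS `SLaw₁₃CoPH` by def-T's faces). [cite: Balaban1989LargeFieldII, Thm 1 p.355; Balaban1988Convergent, Thm 1 p.262 (bookkeeping)] -/
theorem sLaw₁₃CoPH_of_thm1 (h1 : B16.Thm1Printed (datumOfRecord₁₃CoPH F N θ h).C) :
    ∃ γ₁ : ℝ, 0 < γ₁ ∧ ∀ P : B12.RunParams, ((datumOfRecord₁₃CoPH F N θ h).C P).flow.InInterval γ₁ P.K → ∀ k, k ≤ P.K → SLaw₁₃CoPH F N θ P k := by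
  obtain ⟨γ₁, hγ₁, H1⟩ := h1
  exact ⟨γ₁, hγ₁, fun P hP k hk => (sect2Form_coreOfRecord₁₃CoPH_iff F N θ P k).1 (H1 P hP k hk)⟩

/-- **★★★ [III] COR. 3 (`B16.Cor3_250`) AT THE RECORD FROM THEOREM 1 AT THE RECORD + THE FOUR LEAVES ON `]0, γ]`** (adv3's `cor3_250_of_leaves` logic: on `]0, min γ γ₁]` both Theorem 1's
conclusion and the leaves apply).  CONDITIONAL; nothing of Bałaban's asserted. [cite: Balaban1988Convergent, Cor. 3 (2.50) p.264; Balaban1989LargeFieldII, Thm 1 p.355] -/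
theorem cor3_250_datumOfRecord₁₃CoPH_of_thm1_of_repr218Leaves (γ : ℝ) (hγ : 0 < γ) (em ep : ℝ → ℝ)
    (major : (P : B12.RunParams) → (k : ℕ) → (reprOfRecord₁₃ F N θ.toStage13Params P k).Adm → ℝ)
    (s₀ : (P : B12.RunParams) → (k : ℕ) → (reprOfRecord₁₃ F N θ.toStage13Params P k).Adm)
    (h1 : B16.Thm1Printed (datumOfRecord₁₃CoPH F N θ h).C)
    (hU1 : ∀ P : B12.RunParams, ((datumOfRecord₁₃CoPH F N θ h).C P).flow.InInterval γ P.K → ∀ k, k ≤ P.K → SLaw₁₃CoPH F N θ P k →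
      ∀ s V, (reprOfRecord₁₃ F N θ.toStage13Params P k).χ s V * (reprOfRecord₁₃ F N θ.toStage13Params P k).TexpA s V ≤ major P k s)
    (hU2 : ∀ P : B12.RunParams, ((datumOfRecord₁₃CoPH F N θ h).C P).flow.InInterval γ P.K → ∀ k, k ≤ P.K → SLaw₁₃CoPH F N θ P k →
      ∑ s, major P k s ≤ Real.exp (ep (gOfRecord₁₃ F N θ.toStage13Params P k) * (Fintype.card (Site (F.P P.K) k) : ℝ)))
    (hL1 : ∀ P : B12.RunParams, ((datumOfRecord₁₃CoPH F N θ h).C P).flow.InInterval γ P.K → ∀ k, k ≤ P.K → SLaw₁₃CoPH F N θ P k →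
      ∀ s V, 0 ≤ (reprOfRecord₁₃ F N θ.toStage13Params P k).χ s V * (reprOfRecord₁₃ F N θ.toStage13Params P k).TexpA s V)
    (hL2 : ∀ P : B12.RunParams, ((datumOfRecord₁₃CoPH F N θ h).C P).flow.InInterval γ P.K → ∀ k, k ≤ P.K → SLaw₁₃CoPH F N θ P k →
      ∀ V, chiβOfRecord₁₃ F N θ.toStage13Params P.K (gOfRecord₁₃ F N θ.toStage13Params P) k V *
          Real.exp (-(1 / (gOfRecord₁₃ F N θ.toStage13Params P k) ^ 2 * wilsonBGOfRecord F N θ.εbg P k V)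
            - em (gOfRecord₁₃ F N θ.toStage13Params P k) * (Fintype.card (Site (F.P P.K) k) : ℝ)) ≤
        (reprOfRecord₁₃ F N θ.toStage13Params P k).χ (s₀ P k) V * (reprOfRecord₁₃ F N θ.toStage13Params P k).TexpA (s₀ P k) V) :
    B16.Cor3_250 (datumOfRecord₁₃CoPH F N θ h).C := by
  obtain ⟨γ₁, hγ₁, H1⟩ := sLaw₁₃CoPH_of_thm1 F N θ h h1
  refine ⟨min γ γ₁, lt_min hγ hγ₁, em, ep, ?_⟩
  refine cor3With_datumOfRecord₁₃CoPH_of_repr218Leaves F N θ h (min γ γ₁) em ep major s₀ ?_ ?_ ?_ ?_ ?_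
  · exact fun P hP k hk => H1 P (inInterval_of_le hP (min_le_right γ γ₁)) k hk
  · exact fun P hP => hU1 P (inInterval_of_le hP (min_le_left γ γ₁))
  · exact fun P hP => hU2 P (inInterval_of_le hP (min_le_left γ γ₁))
  · exact fun P hP => hL1 P (inInterval_of_le hP (min_le_left γ γ₁))
  · exact fun P hP => hL2 P (inInterval_of_le hP (min_le_left γ γ₁))

/-- **★★★ K1⁷'s (B) CONJUNCT AT THE RECORD** — `B16.EndStatementBPrinted ((datumOfRecord₁₃CoPH θ h).C)` = Theorem 1 ∧ [III] Cor. 3 — FROM THEOREM 1 AT THE RECORD (N11∕N13's 𝐑-row product,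
a HYPOTHESIS here) AND THE FOUR LEAVES U1∕U2∕L1∕L2 ON THE RECORD's OWN HISTORIES on some `]0, γ]` (`B16.endStatementBPrinted_of_leaves` ∘ §3).  This is p. 355's «As an immediate consequence of this
theorem, we get the ultraviolet stability bounds» AT NODE 00's record with leaf (H) discharged and the Cor.-3 content displayed as exactly four families of estimates about `chiSeqOfRecord` and
`slotsOfRecord`.  CONDITIONAL; nothing of Bałaban's asserted; K1⁷ NOT closed (its ∃θ, guard, admissibility and window are elsewhere). [cite: Balaban1989LargeFieldII, Thm 1 p.355, (0.1) pp.355–356, p.391; Balaban1988Convergent, Cor. 3 p.264] -/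
theorem endStatementBPrinted_datumOfRecord₁₃CoPH_of_thm1_of_repr218Leaves (γ : ℝ) (hγ : 0 < γ) (em ep : ℝ → ℝ)
    (major : (P : B12.RunParams) → (k : ℕ) → (reprOfRecord₁₃ F N θ.toStage13Params P k).Adm → ℝ)
    (s₀ : (P : B12.RunParams) → (k : ℕ) → (reprOfRecord₁₃ F N θ.toStage13Params P k).Adm)
    (h1 : B16.Thm1Printed (datumOfRecord₁₃CoPH F N θ h).C)
    (hU1 : ∀ P : B12.RunParams, ((datumOfRecord₁₃CoPH F N θ h).C P).flow.InInterval γ P.K → ∀ k, k ≤ P.K → SLaw₁₃CoPH F N θ P k →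
      ∀ s V, (reprOfRecord₁₃ F N θ.toStage13Params P k).χ s V * (reprOfRecord₁₃ F N θ.toStage13Params P k).TexpA s V ≤ major P k s)
    (hU2 : ∀ P : B12.RunParams, ((datumOfRecord₁₃CoPH F N θ h).C P).flow.InInterval γ P.K → ∀ k, k ≤ P.K → SLaw₁₃CoPH F N θ P k →
      ∑ s, major P k s ≤ Real.exp (ep (gOfRecord₁₃ F N θ.toStage13Params P k) * (Fintype.card (Site (F.P P.K) k) : ℝ)))
    (hL1 : ∀ P : B12.RunParams, ((datumOfRecord₁₃CoPH F N θ h).C P).flow.InInterval γ P.K → ∀ k, k ≤ P.K → SLaw₁₃CoPH F N θ P k →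
      ∀ s V, 0 ≤ (reprOfRecord₁₃ F N θ.toStage13Params P k).χ s V * (reprOfRecord₁₃ F N θ.toStage13Params P k).TexpA s V)
    (hL2 : ∀ P : B12.RunParams, ((datumOfRecord₁₃CoPH F N θ h).C P).flow.InInterval γ P.K → ∀ k, k ≤ P.K → SLaw₁₃CoPH F N θ P k →
      ∀ V, chiβOfRecord₁₃ F N θ.toStage13Params P.K (gOfRecord₁₃ F N θ.toStage13Params P) k V *
          Real.exp (-(1 / (gOfRecord₁₃ F N θ.toStage13Params P k) ^ 2 * wilsonBGOfRecord F N θ.εbg P k V)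
            - em (gOfRecord₁₃ F N θ.toStage13Params P k) * (Fintype.card (Site (F.P P.K) k) : ℝ)) ≤
        (reprOfRecord₁₃ F N θ.toStage13Params P k).χ (s₀ P k) V * (reprOfRecord₁₃ F N θ.toStage13Params P k).TexpA (s₀ P k) V) :
    B16.EndStatementBPrinted (datumOfRecord₁₃CoPH F N θ h).C :=
  ⟨h1, cor3_250_datumOfRecord₁₃CoPH_of_thm1_of_repr218Leaves F N θ h γ hγ em ep major s₀ h1 hU1 hU2 hL1 hL2⟩

end Family

/-! ## §4. n24-c's row binder «(UV₁₃) `hUV`» in its own letters, from the four leaves -/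

section RowHUV

variable (θ : Stage13HParams F N) (w : WorldP)

/-- **★ THE K1⁷ ENGINES' ROW `hUV` FROM THE FOUR LEAVES** (module 36's `b16_main_at_record₁₃CoPH`'s `hUV13` ∕ n24-c's `N24_…_pointed`'s `hUV`, verbatim shape): for every run in `]0, w.γ]` (the history's
flow `genFlow (betaOfRecord₁₃ θ) P.g0`), every `k ≤ P.K` with `SLaw₁₃CoPH θ P k`, and every configuration, the two-sided (UV₁₃) bound on `densOfRecord₁₃` with the world's dependence functions
`w.em`, `w.ep` — from (U1)∕(U2)∕(L1)∕(L2) at `reprOfRecord₁₃ θ P k` under the same guards.  `k = 0` included (dag-n13-w1's level-0 module supplies it outright; this is the all-`k` socket).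
CONDITIONAL on the four leaves; nothing of Bałaban's asserted. [cite: Balaban1988Convergent, Cor. 3 (2.50) p.264; Balaban1989LargeFieldII, (0.1) p.356 (bookkeeping)] -/
theorem hUV₁₃CoPH_of_repr218Leaves
    (major : (P : B12.RunParams) → (k : ℕ) → (reprOfRecord₁₃ F N θ.toStage13Params P k).Adm → ℝ)
    (s₀ : (P : B12.RunParams) → (k : ℕ) → (reprOfRecord₁₃ F N θ.toStage13Params P k).Adm)
    (hU1 : ∀ P : B12.RunParams, (genFlow (betaOfRecord₁₃ F N θ.toStage13Params) P.g0).InInterval w.γ P.K → ∀ k, k ≤ P.K → SLaw₁₃CoPH F N θ P k →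
      ∀ s V, (reprOfRecord₁₃ F N θ.toStage13Params P k).χ s V * (reprOfRecord₁₃ F N θ.toStage13Params P k).TexpA s V ≤ major P k s)
    (hU2 : ∀ P : B12.RunParams, (genFlow (betaOfRecord₁₃ F N θ.toStage13Params) P.g0).InInterval w.γ P.K → ∀ k, k ≤ P.K → SLaw₁₃CoPH F N θ P k →
      ∑ s, major P k s ≤ Real.exp (w.ep (gOfRecord₁₃ F N θ.toStage13Params P k) * (Fintype.card (Site (F.P P.K) k) : ℝ)))
    (hL1 : ∀ P : B12.RunParams, (genFlow (betaOfRecord₁₃ F N θ.toStage13Params) P.g0).InInterval w.γ P.K → ∀ k, k ≤ P.K → SLaw₁₃CoPH F N θ P k →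
      ∀ s V, 0 ≤ (reprOfRecord₁₃ F N θ.toStage13Params P k).χ s V * (reprOfRecord₁₃ F N θ.toStage13Params P k).TexpA s V)
    (hL2 : ∀ P : B12.RunParams, (genFlow (betaOfRecord₁₃ F N θ.toStage13Params) P.g0).InInterval w.γ P.K → ∀ k, k ≤ P.K → SLaw₁₃CoPH F N θ P k →
      ∀ V, chiβOfRecord₁₃ F N θ.toStage13Params P.K (gOfRecord₁₃ F N θ.toStage13Params P) k V *
          Real.exp (-(1 / (gOfRecord₁₃ F N θ.toStage13Params P k) ^ 2 * wilsonBGOfRecord F N θ.εbg P k V)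
            - w.em (gOfRecord₁₃ F N θ.toStage13Params P k) * (Fintype.card (Site (F.P P.K) k) : ℝ)) ≤
        (reprOfRecord₁₃ F N θ.toStage13Params P k).χ (s₀ P k) V * (reprOfRecord₁₃ F N θ.toStage13Params P k).TexpA (s₀ P k) V) :
    ∀ P : B12.RunParams, (genFlow (betaOfRecord₁₃ F N θ.toStage13Params) P.g0).InInterval w.γ P.K → ∀ k, k ≤ P.K → SLaw₁₃CoPH F N θ P k →
      ∀ U : GaugeField (F.P P.K) k (SU N),
        chiβOfRecord₁₃ F N θ.toStage13Params P.K (gOfRecord₁₃ F N θ.toStage13Params P) k U *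
              Real.exp (-(1 / (gOfRecord₁₃ F N θ.toStage13Params P k) ^ 2 * wilsonBGOfRecord F N θ.εbg P k U)
                - w.em (gOfRecord₁₃ F N θ.toStage13Params P k) * (Fintype.card (Site (F.P P.K) k) : ℝ)) ≤ densOfRecord₁₃ F N θ.toStage13Params P k U ∧
        densOfRecord₁₃ F N θ.toStage13Params P k U ≤ Real.exp (w.ep (gOfRecord₁₃ F N θ.toStage13Params P k) * (Fintype.card (Site (F.P P.K) k) : ℝ)) :=
  fun P hP k hk hs U =>
    ⟨le_densOfRecord₁₃_of_L1_L2 F N θ P k (s₀ P k) _ (hL1 P hP k hk hs) (hL2 P hP k hk hs) U,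
      densOfRecord₁₃_le_of_U1_U2 F N θ P k (major P k) _ (hU1 P hP k hk hs) (hU2 P hP k hk hs) U⟩

end RowHUV

end Summit.QuantumFields.YangMills.BalabanUVNodes.N13Cor3Repr218LeavesAtRecord13CoPH

end
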